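import Mathlib
import Summits.NavierStokesRegularity.NavierStokesRegularity.Theorems.FilamentSkeletonRssStadiumCornerQuantFeet

/-!
# Route `FilamentSkeletonRss` · child crux `TangentSkeletonNearStraightL` (stmt-NavierStokesRegularity-23320) · registered line
# `child_tangent_analytic_strip_L` (b0b56c52900dd90a), stub `stub_stripPropagation` — assembly: QUANTITATIVE MARGIN OF THE FAR SOURCES

`far_source_re_ge`: the gap form of `Theorems.StadiumCornerFarSource.far_source_re_pos` — for a target `z = x₀ + iY` (`0 ≤ Y < hs/4`,
target-leg radius `3hs/4` admissible) and a source `ζ = (x₀ + a) + iη` with `a ≥ hs`, `0 ≤ η ≤ Y`, foot room `hs/2`: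
`(0.14·hs)² ≤ Re Σᵢ (Fᵢ(ζ) − Fᵢ(z))²` (`Theorems.StadiumCornerQuantFeet.two_feet_re_ge_of_num` with `R₂ = hs/2`, `ηs = hs/4`, `log 2 ≥ 0.6931`).
HONEST FRAMING: bookkeeping for a HYPOTHETICAL filament skeleton on the NEGATIVE side of a MODEL route; the stub `stub_stripPropagation` is NOT
closed by this file; nothing here bears on Navier–Stokes regularity or blow-up.  `--supports stmt-NavierStokesRegularity-23320`.
-/

set_option linter.dupNamespace false

noncomputable section

namespace Summit.NavierStokesRegularity.NavierStokesRegularity.Theorems.StadiumCornerQuantFar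

open Set MeasureTheory
open scoped InnerProductSpace BigOperators
open Summit.NavierStokesRegularity.NavierStokesRegularity.Theorems.StadiumCornerRightDescentFar
open Summit.NavierStokesRegularity.NavierStokesRegularity.Theorems.StadiumCornerQuantFeet

/-- **Far sources, quantitative.**  Stadium `S = {|Im| < hs, |Re − cc| < L + hs}`, `F` holomorphic on `S` with `‖F′‖ ≤ 2`, `Σ (F′)ᵢ² = 1`,
`F = cplx ∘ X` on the real trace, `X` of class `C¹` with unit speed and tangent oscillation `≤ Rb ≤ 1/2`; target `z = x₀ + iY` with
`0 ≤ Y < hs/4` and `|x₀ − cc| + 3hs/4 < L + hs`; source `ζ = (x₀ + a) + iη` with `a ≥ hs`, `0 ≤ η ≤ Y`, `|x₀ + a − cc| + hs/2 < L + hs`;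
QUANTITATIVE: `(0.14·hs)² ≤ Re Σᵢ (Fᵢ(ζ) − Fᵢ(z))²`. [folklore] -/
theorem far_source_re_ge {hs L cc : ℝ} {F : ℂ → (Fin 3 → ℂ)}
    (hF : DifferentiableOn ℂ F {z : ℂ | |z.im| < hs ∧ |z.re - cc| < L + hs})
    (hM : ∀ z ∈ {z : ℂ | |z.im| < hs ∧ |z.re - cc| < L + hs}, ‖deriv F z‖ ≤ 2)
    (hunit : ∀ w ∈ {z : ℂ | |z.im| < hs ∧ |z.re - cc| < L + hs}, ∑ i, (deriv F w i) ^ 2 = 1)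
    {X : ℝ → EuclideanSpace ℝ (Fin 3)} (hX : ContDiff ℝ 1 X) (hXu : ∀ τ, ‖deriv X τ‖ = 1)
    {Rb : ℝ} (hRb0 : 0 ≤ Rb) (hRb : Rb ≤ 1 / 2) (hosc : ∀ τ σ, ‖deriv X τ - deriv X σ‖ ≤ Rb)
    (hFX : ∀ r : ℝ, (r : ℂ) ∈ {z : ℂ | |z.im| < hs ∧ |z.re - cc| < L + hs} →
      F r = fun i => ((⟪X r, EuclideanSpace.single i (1:ℝ)⟫_ℝ : ℝ) : ℂ))
    (hhs : 0 < hs) {x₀ Y a η : ℝ} (hY0 : 0 ≤ Y) (hY : Y < hs / 4) (hR₁end : |x₀ - cc| + 3 * hs / 4 < L + hs)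
    (ha : hs ≤ a) (hη0 : 0 ≤ η) (hηY : η ≤ Y) (hR₂end : |x₀ + a - cc| + hs / 2 < L + hs)
    :
    (0.14 * hs) ^ 2 ≤ (∑ i, (F (((x₀ + a : ℝ) : ℂ) + (η : ℂ) * Complex.I) i - F ((x₀ : ℂ) + (Y : ℂ) * Complex.I) i) ^ 2).re := by
  have ha0 : 0 < a := lt_of_lt_of_le hhs ha
  have hR₂pos : 0 < hs * (1 / 2) := by positivity
  have hR₂hs : hs * (1 / 2) < hs := by linarith
  have hR₂end' : |x₀ + a - cc| + hs * (1 / 2) < L + hs := by linarith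
  have hηs : η ≤ hs * (1 / 4) := by linarith
  have hηsR : hs * (1 / 4) < hs * (1 / 2) := by linarith
  have hSs : (Y - η) ^ 2 + Y * η / 4 ≤ (1 / 4 * hs) ^ 2 := by
    have h1 : (Y - η) ^ 2 + Y * η / 4 ≤ Y ^ 2 := by nlinarith
    have h2 : Y ^ 2 ≤ (hs / 4) ^ 2 := pow_le_pow_left₀ hY0 hY.le 2
    nlinarith
  refine two_feet_re_ge_of_num hF hM hunit hX hXu hRb0 hRb hosc hFX hhs (g := 0.14 * hs) (by positivity) hY0 hY hR₁end ha0
    hR₂pos hR₂hs hR₂end' hη0 hηs hηsR hSs ?_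
  -- decimals: `r = 1/2`, `e = 1/4`, `ℓ = log 2 ≥ 0.6931`, `q = 1/4`
  have hlog : Real.log (hs * (1 / 2) / (hs * (1 / 2) - hs * (1 / 4))) = Real.log ((1 / 2 : ℝ) / (1 / 2 - 1 / 4)) := by
    rw [← mul_sub, mul_div_mul_left _ _ hhs.ne']
  have hsq : √((1 / 4 * hs) ^ 2) = 1 / 4 * hs := Real.sqrt_sq (by positivity)
  rw [hlog, hsq]
  have hℓ : (0.6931 : ℝ) ≤ Real.log ((1 / 2 : ℝ) / (1 / 2 - 1 / 4)) := by
    rw [show (1 / 2 : ℝ) / (1 / 2 - 1 / 4) = 2 by norm_num]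
    have := Real.log_two_gt_d9
    linarith
  have hred := foot_reduce_le (r := 1 / 2) (e := 1 / 4) (ℓ₀ := 0.6931) (P := 1 / 4 + 0.0389) (M := 7 / 8 - 0.0398)
    (g := 0.14) (by norm_num) (by norm_num) (by norm_num) hℓ (by norm_num) (by norm_num)
  generalize hℓv : Real.log ((1 / 2 : ℝ) / (1 / 2 - 1 / 4)) = ℓ at hred ⊢
  have e1 : (hs * (1 / 4)) ^ 2 / (2 * (hs * (1 / 2))) = hs * ((1 / 4 : ℝ) ^ 2 / (2 * (1 / 2))) := by field_simp
  have e2 : ((hs * (1 / 2)) ^ 2 - (hs * (1 / 4)) ^ 2) * ℓ / (2 * (hs * (1 / 2))) =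
      hs * (((1 / 2 : ℝ) ^ 2 - (1 / 4) ^ 2) * ℓ / (2 * (1 / 2))) := by field_simp
  have e3 : (hs * (1 / 4)) ^ 2 / (4 * (hs * (1 / 2))) = hs * ((1 / 4 : ℝ) ^ 2 / (4 * (1 / 2))) := by field_simp
  rw [e1, e2, e3]
  have h1 := mul_le_mul_of_nonneg_left hred hhs.le
  have ha1 : hs * (7 / 8 - 0.0398) ≤ 7 / 8 * a - 0.0398 * hs := by linarith
  linarith only [h1, ha1]



end Summit.NavierStokesRegularity.NavierStokesRegularity.Theorems.StadiumCornerQuantFar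

end
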